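import Mathlib
import Literature.MathematicalPhysics.KineticTheory.HardSphereEuler
import Literature.Analysis.FluidPDE.HardSphereCollisionRecord
import Literature.Analysis.FluidPDE.HardSphereCollisionEnumeration
import Summits.AtomisticToContinuum.HydrodynamicLimit.Theorems.OneFlightGossipEngineOneFlightLayeredChaosWindowEvent
import HarnessLib

/-!
# `InformationPercolationEngine.CollisionRate` — the windowed collision count of one sphere is a measurable
function of the initial datum (crux stmt-AtomisticToContinuum-13481, line `Sketch`, card `hazard-fairness-compensator`,
helper stub H1 `stub_windowCountMeasurable`)

Helper file (`--supports stmt-AtomisticToContinuum-13481`) proving the registered stub `stub_windowCountMeasurable`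
(H1) of the lead's checked skeleton for the crux
`Summit.AtomisticToContinuum.HydrodynamicLimit.Theses.InformationPercolationEngine.CollisionRate`, line `Sketch`
(card `hazard-fairness-compensator`).  The statement is spelled exactly as registered.

Content.  The line compensates the windowed collision COUNT
`D(z) = #{collision times of sphere i in [s, t) along the orbit of z}` by a conditional expectation (Mathlib
`condExp`), which is junk unless the integrand is measurable; this file proves that the count, as a function of
the initial datum `z` (cut to the good set `Φ.good`, value `0` off it), is Borel measurable, for EVERY pair of
reals `s, t` and with no smallness/regularity hypothesis on the diameter (the registered hypotheses
`0 < σ < 1/2` are not used).  The argument is the one of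
`Summits/…/Theorems/OneFlightGossipEngineOneFlightLayeredChaosWindowEvent.lean` (window `(0, w]`) run for the
half-open window `[s, t)`:

* `le_ncard_collisionTimesOf_inter_Ico_iff` — along a good orbit (collision times locally finite,
  `IsHardSphereTrajectory.finite_collisionTimesOf_inter_of_subset_Icc`), "at least `m` collisions of `k` in
  `[s, t)`" holds iff there are rationals `a₁ ≤ b₁ < a₂ ≤ b₂ < ⋯ ≤ b_m < t` with a collision of `k` in each
  closed interval `[max s a_j, b_j]` (a countable condition);
* `measurableSet_good_inter_le_ncard_collisionTimesOf_inter_Ico` — hence `Φ.good ∩ {m ≤ count}` is measurable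
  (each event "collision of `k` in `[a, b]`, `z` good" is measurable:
  `measurableSet_good_inter_exists_participates_Icc`);
* `measurable_ite_ncard_collisionTimesOf_inter_Ico` — the `ℕ`-valued count cut to the good set is measurable
  (level sets, `measurable_to_countable'`), and `measurable_windowCount` — so is its real cast;
* `stub_windowCountMeasurable` — the registered signature (`d = Fin 3`, `N + 1` spheres of diameter
  `hsDiameter σ N`).

No new definitions; no dynamics beyond the structure fields of `HardSphereFlow`.
-/

noncomputable section

open MeasureTheory Set Filter Topology
open scoped Classical
open Literature.Analysis.FluidPDE Literature.MathematicalPhysics.KineticTheory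

namespace Summit.AtomisticToContinuum.HydrodynamicLimit.Theorems.CollisionRate

variable {d : Type*} [Fintype d] {N : ℕ} {ε : ℝ}

/-- **"At least `m` collisions of `k` in `[s, t)`", along a good orbit, is a countable condition**: it holds iff
there are rationals `(a_j, b_j)_{j < m}` with `b_j < t`, `b_j < a_{j+1}`, and a collision of `k` in each closed
interval `[max s a_j, b_j]` (local finiteness of the collision times of a hard-sphere trajectory + density of `ℚ`).
[folklore] -/
theorem le_ncard_collisionTimesOf_inter_Ico_iff (Φ : HardSphereFlow (Torus.geometry d) ε N) (k : Fin N)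
    {z : Config N d (UnitAddTorus d)} (hz : z ∈ Φ.good) (m : ℕ) (s t : ℝ) :
    m ≤ (collisionTimesOf (Torus.geometry d) ε (fun u => Φ.flow u z) k ∩ Ico s t).ncard ↔
      ∃ ab : Fin m → ℚ × ℚ,
        (∀ j, ((ab j).2 : ℝ) < t ∧ ∃ u ∈ Icc (max s ((ab j).1 : ℝ)) ((ab j).2 : ℝ),
            Participates (Torus.geometry d) ε (Φ.flow u z) k) ∧
        (∀ j j' : Fin m, j.1 + 1 = j'.1 → ((ab j).2 : ℝ) < (ab j').1) := by
  have hfin : (collisionTimesOf (Torus.geometry d) ε (fun u => Φ.flow u z) k ∩ Ico s t).Finite :=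
    (Φ.isTrajectory z hz).finite_collisionTimesOf_inter_of_subset_Icc k Ico_subset_Icc_self
  constructor
  · intro hm
    -- enumerate the collision times increasingly
    set F := hfin.toFinset with hF
    have hcard : m ≤ F.card := by rwa [hF, ← Set.ncard_eq_toFinset_card _ hfin]
    set e := F.orderEmbOfFin rfl with he
    let tt : Fin m → ℝ := fun j => e ⟨j.1, lt_of_lt_of_le j.2 hcard⟩
    have ht_mem : ∀ j, tt j ∈ collisionTimesOf (Torus.geometry d) ε (fun u => Φ.flow u z) k ∩ Ico s t :=
      fun j => (Set.Finite.mem_toFinset hfin).1 (F.orderEmbOfFin_mem rfl _)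
    have ht_mono : ∀ j j' : Fin m, j.1 < j'.1 → tt j < tt j' := fun j j' h =>
      e.strictMono (show (⟨j.1, _⟩ : Fin F.card) < ⟨j'.1, _⟩ from h)
    -- the upper rationals b_j ∈ (t_j, next), next = t_{j+1} or the window end t
    let up : Fin m → ℝ := fun j => if h : j.1 + 1 < m then tt ⟨j.1 + 1, h⟩ else t
    have htu : ∀ j, tt j < up j := by
      intro j
      by_cases h : j.1 + 1 < m
      · simp only [up, dif_pos h]; exact ht_mono _ _ (by simp)
      · simp only [up, dif_neg h]; exact (ht_mem j).2.2
    have hup_le : ∀ j, up j ≤ t := by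
      intro j
      by_cases h : j.1 + 1 < m
      · simp only [up, dif_pos h]; exact (ht_mem _).2.2.le
      · simp only [up, dif_neg h]; exact le_rfl
    choose b hb using fun j => exists_rat_btwn (htu j)
    -- the lower rationals a_j ∈ (previous, t_j), previous = b_{j-1} or t_j - 1
    let lo : Fin m → ℝ := fun j => if h : 0 < j.1 then (b ⟨j.1 - 1, by omega⟩ : ℝ) else tt j - 1
    have hlt : ∀ j, lo j < tt j := by
      intro j
      by_cases h : 0 < j.1
      · simp only [lo, dif_pos h]
        have h1 : (⟨j.1 - 1, by omega⟩ : Fin m).1 + 1 < m := by simp; omega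
        have := (hb ⟨j.1 - 1, by omega⟩).2
        simp only [up, dif_pos h1] at this
        have heq : (⟨(⟨j.1 - 1, by omega⟩ : Fin m).1 + 1, h1⟩ : Fin m) = j := by
          ext; simp; omega
        rw [heq] at this
        exact this
      · simp only [lo, dif_neg h]; linarith
    choose a ha using fun j => exists_rat_btwn (hlt j)
    refine ⟨fun j => (a j, b j), fun j => ⟨(hb j).2.trans_le (hup_le j), tt j,
      ⟨max_le (ht_mem j).2.1 (ha j).2.le, (hb j).1.le⟩, (ht_mem j).1⟩, fun j j' hjj' => ?_⟩
    -- b_j < a_{j'} for consecutive indices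
    have hpos : 0 < j'.1 := by omega
    have := (ha j').1
    simp only [lo, dif_pos hpos] at this
    have heq : (⟨j'.1 - 1, by omega⟩ : Fin m) = j := by ext; simp; omega
    rw [heq] at this
    exact this
  · rintro ⟨ab, hcoll, hsucc⟩
    choose u hu using fun j => (hcoll j).2
    -- u is strictly increasing along successors, hence injective
    have hsucc' : ∀ j j' : Fin m, j.1 + 1 = j'.1 → u j < u j' := by
      intro j j' h
      calc u j ≤ ((ab j).2 : ℝ) := (hu j).1.2
        _ < (ab j').1 := hsucc j j' h
        _ ≤ max s ((ab j').1 : ℝ) := le_max_right _ _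
        _ ≤ u j' := (hu j').1.1
    have hlt : ∀ (p : ℕ) (j j' : Fin m), j.1 + p + 1 = j'.1 → u j < u j' := by
      intro p
      induction p with
      | zero => intro j j' h; exact hsucc' j j' (by omega)
      | succ p ih =>
        intro j j' h
        have hmid : j.1 + p + 1 < m := by omega
        exact (ih j ⟨j.1 + p + 1, hmid⟩ (by simp)).trans (hsucc' ⟨j.1 + p + 1, hmid⟩ j' (by simp; omega))
    have hinj : Function.Injective u := by
      intro j j' h
      rcases lt_trichotomy j.1 j'.1 with hjj | hjj | hjj
      · exact absurd h (ne_of_lt (hlt (j'.1 - j.1 - 1) j j' (by omega)))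
      · exact Fin.ext hjj
      · exact absurd h (ne_of_gt (hlt (j.1 - j'.1 - 1) j' j (by omega)))
    have hsub : Set.range u ⊆ collisionTimesOf (Torus.geometry d) ε (fun u => Φ.flow u z) k ∩ Ico s t := by
      rintro _ ⟨j, rfl⟩
      exact ⟨(hu j).2, (le_max_left _ _).trans (hu j).1.1, (hu j).1.2.trans_lt (hcoll j).1⟩
    calc m = (Set.range u).ncard := by
          rw [← Set.image_univ, Set.ncard_image_of_injective _ hinj, Set.ncard_univ, Nat.card_fin]
      _ ≤ _ := Set.ncard_le_ncard hsub hfin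

/-- **The event "`z` good and at least `m` collisions of `k` in `[s, t)`" is measurable**: it is a countable union,
over admissible rational interval systems, of finite intersections of the measurable events "collision of `k` in a
closed interval, `z` good" (`measurableSet_good_inter_exists_participates_Icc`). [folklore] -/
theorem measurableSet_good_inter_le_ncard_collisionTimesOf_inter_Ico (Φ : HardSphereFlow (Torus.geometry d) ε N)
    (k : Fin N) (m : ℕ) (s t : ℝ) :
    MeasurableSet (Φ.good ∩ {z : Config N d (UnitAddTorus d) |
      m ≤ (collisionTimesOf (Torus.geometry d) ε (fun u => Φ.flow u z) k ∩ Ico s t).ncard}) := by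
  -- the admissible rational interval systems (a condition not involving `z`)
  let Adm : (Fin m → ℚ × ℚ) → Prop := fun ab =>
    (∀ j, ((ab j).2 : ℝ) < t) ∧ (∀ j j' : Fin m, j.1 + 1 = j'.1 → ((ab j).2 : ℝ) < (ab j').1)
  let E : ℚ × ℚ → Set (Config N d (UnitAddTorus d)) := fun q =>
    Φ.good ∩ {z | ∃ u ∈ Icc (max s (q.1 : ℝ)) (q.2 : ℝ), Participates (Torus.geometry d) ε (Φ.flow u z) k}
  have hE : ∀ q, MeasurableSet (E q) := fun q =>
    measurableSet_good_inter_exists_participates_Icc Φ k _ _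
  have hrepr : Φ.good ∩ {z : Config N d (UnitAddTorus d) |
        m ≤ (collisionTimesOf (Torus.geometry d) ε (fun u => Φ.flow u z) k ∩ Ico s t).ncard} =
      ⋃ ab : Fin m → ℚ × ℚ, if Adm ab then Φ.good ∩ ⋂ j, E (ab j) else ∅ := by
    ext z
    simp only [mem_inter_iff, mem_setOf_eq, mem_iUnion]
    constructor
    · rintro ⟨hz, hm⟩
      obtain ⟨ab, hcoll, hsucc⟩ := (le_ncard_collisionTimesOf_inter_Ico_iff Φ k hz m s t).1 hm
      refine ⟨ab, ?_⟩
      rw [if_pos ⟨fun j => (hcoll j).1, hsucc⟩]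
      exact ⟨hz, mem_iInter.2 fun j => ⟨hz, (hcoll j).2⟩⟩
    · rintro ⟨ab, h⟩
      by_cases hadm : Adm ab
      · rw [if_pos hadm] at h
        obtain ⟨hz, hall⟩ := h
        refine ⟨hz, (le_ncard_collisionTimesOf_inter_Ico_iff Φ k hz m s t).2
          ⟨ab, fun j => ⟨hadm.1 j, ?_⟩, hadm.2⟩⟩
        exact ((mem_iInter.1 hall) j).2
      · rw [if_neg hadm] at h
        exact absurd h (notMem_empty _)
  rw [hrepr]
  refine MeasurableSet.iUnion fun ab => ?_
  split_ifs
  · exact Φ.measurableSet_good.inter (MeasurableSet.iInter fun j => hE _)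
  · exact MeasurableSet.empty

/-- **The `ℕ`-valued window count, cut to the good set, is measurable**: its super-level sets `{m ≤ ·}` are `univ`
(`m = 0`) or the events of `measurableSet_good_inter_le_ncard_collisionTimesOf_inter_Ico` (`m ≥ 1`), and an
`ℕ`-valued function with measurable level sets is measurable (`measurable_to_countable'`). [folklore] -/
theorem measurable_ite_ncard_collisionTimesOf_inter_Ico (Φ : HardSphereFlow (Torus.geometry d) ε N) (k : Fin N)
    (s t : ℝ) :
    Measurable fun z : Config N d (UnitAddTorus d) =>
      if z ∈ Φ.good then (collisionTimesOf (Torus.geometry d) ε (fun u => Φ.flow u z) k ∩ Ico s t).ncard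
      else 0 := by
  set g : Config N d (UnitAddTorus d) → ℕ := fun z =>
    if z ∈ Φ.good then (collisionTimesOf (Torus.geometry d) ε (fun u => Φ.flow u z) k ∩ Ico s t).ncard
    else 0 with hg
  -- super-level sets
  have hlev : ∀ m : ℕ, MeasurableSet {z | m ≤ g z} := by
    intro m
    rcases Nat.eq_zero_or_pos m with rfl | hm
    · have : {z | 0 ≤ g z} = univ := eq_univ_of_forall fun z => Nat.zero_le _
      rw [this]
      exact MeasurableSet.univ
    · have : {z | m ≤ g z} = Φ.good ∩ {z : Config N d (UnitAddTorus d) |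
          m ≤ (collisionTimesOf (Torus.geometry d) ε (fun u => Φ.flow u z) k ∩ Ico s t).ncard} := by
        ext z
        simp only [mem_setOf_eq, mem_inter_iff, hg]
        by_cases hz : z ∈ Φ.good
        · rw [if_pos hz]
          exact ⟨fun h => ⟨hz, h⟩, fun h => h.2⟩
        · rw [if_neg hz]
          constructor
          · intro h; omega
          · intro h; exact absurd h.1 hz
      rw [this]
      exact measurableSet_good_inter_le_ncard_collisionTimesOf_inter_Ico Φ k m s t
  refine measurable_to_countable' fun m => ?_
  have : g ⁻¹' {m} = {z | m ≤ g z} \ {z | m + 1 ≤ g z} := by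
    ext z
    simp only [mem_preimage, mem_singleton_iff, Set.mem_sdiff, mem_setOf_eq]
    omega
  rw [this]
  exact (hlev m).diff (hlev (m + 1))

/-- **The window count is measurable** (real-valued form): for every flow `Φ` on the torus, particle `k` and reals
`s, t`, the number of collision times of `k` in `[s, t)` along the orbit of `z` (on the good set; `0` off it), cast
to `ℝ`, is a Borel measurable function of the initial datum `z`. [folklore] -/
theorem measurable_windowCount (Φ : HardSphereFlow (Torus.geometry d) ε N) (k : Fin N) (s t : ℝ) :
    Measurable fun z : Config N d (UnitAddTorus d) =>
      if z ∈ Φ.good then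
        ((collisionTimesOf (Torus.geometry d) ε (fun u => Φ.flow u z) k ∩ Ico s t).ncard : ℝ)
      else 0 := by
  have hfun : (fun z : Config N d (UnitAddTorus d) =>
      if z ∈ Φ.good then
        ((collisionTimesOf (Torus.geometry d) ε (fun u => Φ.flow u z) k ∩ Ico s t).ncard : ℝ)
      else 0) = (fun n : ℕ => (n : ℝ)) ∘ fun z : Config N d (UnitAddTorus d) =>
      if z ∈ Φ.good then (collisionTimesOf (Torus.geometry d) ε (fun u => Φ.flow u z) k ∩ Ico s t).ncard
      else 0 := by
    ext z
    simp only [Function.comp_apply]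
    split_ifs <;> simp
  rw [hfun]
  exact measurable_from_nat.comp (measurable_ite_ncard_collisionTimesOf_inter_Ico Φ k s t)

/-- **H1 · the window count is measurable** (registered stub `stub_windowCountMeasurable` of line `Sketch`, card
`hazard-fairness-compensator`, crux `InformationPercolationEngine.CollisionRate`).  For `0 < σ < 1/2`, every `N`,
flow `Φ` of `N + 1` spheres of diameter `hsDiameter σ N` on `𝕋³`, sphere `i` and reals `s, t`: the number of
collision times of `i` in `[s, t)` along the orbit of `z` (on the good set; `0` off it) is a Borel measurable function
of the initial datum `z` — `measurable_windowCount` (the hypotheses on `σ` are not needed). [folklore] -/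
theorem stub_windowCountMeasurable :
    ∀ (σ : ℝ) (N : ℕ) (Φ : HardSphereFlow (Torus.geometry (Fin 3)) (hsDiameter σ N) (N + 1))
      (i : Fin (N + 1)) (s t : ℝ), 0 < σ → σ < 1 / 2 →
      Measurable (fun z : Config (N + 1) (Fin 3) T3 =>
        if z ∈ Φ.good then
          ((collisionTimesOf (Torus.geometry (Fin 3)) (hsDiameter σ N) (fun u => Φ.flow u z) i ∩
              Set.Ico s t).ncard : ℝ)
        else 0) :=
  fun _ _ Φ i s t _ _ => measurable_windowCount Φ i s t

end Summit.AtomisticToContinuum.HydrodynamicLimit.Theorems.CollisionRate
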